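import Summits.FinalStateConjecture.FinalStateConjecture.Theorems.SoloBlindOrientation
import Summits.FinalStateConjecture.FinalStateConjecture.Theorems.SoloBlindDispersal
import Literature.Geometry.Lorentzian.TimelikeRayCauchy
import Literature.Geometry.Lorentzian.CausalityPushUp
import Literature.Geometry.Lorentzian.CausalityAchronalProofs

/-!
# Solo (blind) — an asymptotically flat chart tied to a Cauchy hypersurface is future-oriented

Gap **F2** of the seat's statement paper (§13.2), closed. Let `(M, g, T)` be a spacetime with a
Cauchy hypersurface `S`, and `Ψ : E4 → M` a smooth chart read whose `Cᵏ` deviation from the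
Minkowski background on the slabs `{x⁰ = τ}`, `τ ≥ τ₁`, is at most `1/10`, and whose late region
`Ψ({x⁰ > τ₀})` lies in `J⁺(S)` (the tie (c) of the seat's tied flat chart). Then `dΨ(∂₀)` is
future-directed timelike at every chart point with `x⁰ ≥ τ₁`
(`soloBlind_orientedBeyond_of_isCauchyHypersurface`). By the dichotomy of
`Theorems/SoloBlindOrientation.lean` it suffices to exclude the anti-oriented branch: there a
chart-time ray `γ(s) = Ψ(x₀ + s ∂₀)`, `s ≥ 0`, is a uniformly timelike (`g(γ', γ') ≤ -9/10`)
future ray for the REVERSED time orientation, hence endless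
(`TimeOrientation.isFutureEndless_Ici_of_val_velocity_le`), hence eventually in the causal future
of `S` for `-T`, i.e. in `J⁻(S)` (`IsCauchyHypersurface.exists_forall_mem_causalFuture_of_…`, time
dual); but the whole ray lies in `J⁺(S)` by the tie, and two of its points `γ(s₀ + 1) ≪ γ(s₀)` give
`σ ≤ γ(s₀ + 1) ≪ γ(s₀) ≤ σ'` with `σ, σ' ∈ S`, so `σ ≪ σ'` (push-up, O'Neill 1983, Cor. 14.1),
contradicting the achronality of a Cauchy hypersurface (O'Neill 1983, Lemma 14.29).

Consequence: hypothesis (d) of the seat's tied flat chart (`SoloBlindTiedFlatChart`,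
`Theorems/SoloBlindDispersal.lean`) follows from (a)–(c) there together with `C⁰`-smallness
(`≤ 1/10`) of the deviation from `τ₀` on (`SoloBlindTiedFlatChart.ofDeviationLe`); the remaining
difference between the hypothesis of rung r1b and the recorded consequence form of the stability
of Minkowski space is the tie (c) alone (gap F1) plus that smallness.

References: B. O'Neill, *Semi-Riemannian geometry* (1983), Ch. 5, Lemma 5.26; Ch. 14, Cor. 14.1
(p. 402), Def. 14.28 and Lemma 14.29 (p. 415); S. W. Hawking, G. F. R. Ellis, *The large scale
structure of space-time* (1973), §6.2 (endpoints), §6.5; D. Christodoulou, S. Klainerman, *The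
global nonlinear stability of the Minkowski space* (1993), Thm. 1.0.2, Thm. 10.2.1.
-/

noncomputable section

open Literature.Geometry.Lorentzian TopologicalSpace Manifold Filter Topology Set Function
open scoped ContDiff Topology ENNReal

namespace Summit.FinalStateConjecture.FinalStateConjecture.Theorems

section Spacetime

variable {𝓢 : Spacetime.{0} 4}

/-- **Uniform timelike bound on chart time**: if the deviation on the slab through `x` is at most
`1/10`, then `g(dΨ_x ∂₀, dΨ_x ∂₀) ≤ -9/10` (`η(∂₀, ∂₀) = -1`). Christodoulou–Klainerman 1993,
Thm. 1.0.2 (the deviation `g − η`). -/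
theorem soloBlind_val_basisVector_le {Ψ : Minkowski.background.domain → 𝓢.carrier} (k : ℕ)
    {x : Minkowski.background.domain}
    (h : 𝓢.deviationCk Minkowski.background Ψ k (x.1 0) ≤ ENNReal.ofReal (1 / 10)) :
    𝓢.metric.val (Ψ x) (mfderiv 𝓘(ℝ, E4) (𝓡 4) Ψ x (E4.basisVector 0))
        (mfderiv 𝓘(ℝ, E4) (𝓡 4) Ψ x (E4.basisVector 0)) ≤ -(9 / 10) := by
  have hn0 : ‖(E4.basisVector 0 : E4)‖ = 1 := by
    rw [E4.basisVector, EuclideanSpace.single, PiLp.norm_single, norm_one]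
  have hb := soloBlind_abs_pullback_sub_bilin_le Ψ k (by norm_num : (0 : ℝ) ≤ 1 / 10) h
    (E4.basisVector 0) (E4.basisVector 0)
  rw [Minkowski.bilin_basisVector_zero, hn0, mul_one, mul_one] at hb
  linarith [(abs_le.mp hb).2]

/-- **No anti-oriented asymptotically flat chart tied to a Cauchy hypersurface.** If `S` is a
Cauchy hypersurface, the `Cᵏ` deviation of the smooth chart read `Ψ` is at most `1/10` on the slabs
`{x⁰ = τ}`, `τ ≥ τ₁`, and `Ψ({x⁰ > τ₀}) ⊆ J⁺(S)`, then `Ψ` is not anti-oriented beyond `τ₁`: an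
anti-oriented chart-time ray is an endless uniformly timelike ray for `-T`, so eventually in
`J⁻(S)`, while it lies in `J⁺(S)`; two of its points then give `σ ≪ σ'` in `S` (push-up), against
achronality. O'Neill 1983, Ch. 14, Cor. 14.1, Def. 14.28, Lemma 14.29; Hawking–Ellis 1973, §6.2. -/
theorem soloBlind_not_antiOrientedBeyond_of_isCauchyHypersurface {S : Set 𝓢.carrier}
    (hS : 𝓢.metric.IsCauchyHypersurface 𝓢.timeOrientation S)
    {Ψ : Minkowski.background.domain → 𝓢.carrier} (hΨ : ContMDiff 𝓘(ℝ, E4) (𝓡 4) ∞ Ψ) (k : ℕ)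
    {τ₀ τ₁ : ℝ} (hdev : ∀ τ, τ₁ ≤ τ →
      𝓢.deviationCk Minkowski.background Ψ k τ ≤ ENNReal.ofReal (1 / 10))
    (htie : Ψ '' Minkowski.background.lateRegion τ₀ ⊆
      𝓢.metric.causalFuture 𝓢.timeOrientation S) :
    ¬ SoloBlindAntiOrientedBeyond Ψ τ₁ := by
  intro hanti
  have hn1 : (1 : ℕ∞ω) ≤ ((⊤ : ℕ∞) : ℕ∞ω) := WithTop.coe_le_coe.2 le_top
  have hn2 : (2 : ℕ∞ω) ≤ ((⊤ : ℕ∞) : ℕ∞ω) := WithTop.coe_le_coe.2 le_top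
  -- a late base point and its chart-time ray `γ(s) = Ψ(x₀ + s ∂₀)`
  set x₀ : E4 := (max τ₀ τ₁ + 1) • E4.basisVector 0 with hx₀
  have hpt0 : ∀ s : ℝ, (x₀ + s • E4.basisVector 0) 0 = max τ₀ τ₁ + 1 + s := by
    intro s; simp [hx₀, E4.basisVector]
  set γ : ℝ → 𝓢.carrier := soloBlindLineCurve Ψ x₀ (E4.basisVector 0) with hγ
  -- along the ray, for `s ≥ 0`: differentiable, `g(γ', γ') ≤ -9/10`, future-directed for `-T`
  have hray : ∀ s : ℝ, 0 ≤ s → MDifferentiableAt 𝓘(ℝ, ℝ) (𝓡 4) γ s ∧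
      𝓢.metric.val (γ s) (velocity (𝓡 4) γ s) (velocity (𝓡 4) γ s) ≤ -(9 / 10) ∧
        𝓢.timeOrientation.reverse.IsFutureDirected (velocity (𝓡 4) γ s) := by
    intro s hs
    obtain ⟨hd, hv⟩ := soloBlind_velocity_lineCurve hΨ x₀ (E4.basisVector 0) s
    have hτ₁ : τ₁ ≤ (x₀ + s • E4.basisVector 0) 0 := by
      rw [hpt0]; linarith [le_max_right τ₀ τ₁]
    refine ⟨hd, ?_, ?_⟩
    · rw [hv]; exact soloBlind_val_basisVector_le k (x := ⟨_, trivial⟩) (hdev _ hτ₁)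
    · rw [hv, TimeOrientation.isFutureDirected_reverse_iff]
      exact (hanti ⟨_, trivial⟩ hτ₁).2
  have hcurve : 𝓢.metric.IsFutureTimelikeCurveOn 𝓢.timeOrientation.reverse γ (Ici 0) := by
    intro s hs
    obtain ⟨hd, hv, hf⟩ := hray s (mem_Ici.mp hs)
    exact ⟨hd, by rw [LorentzianMetric.isTimelike_iff]; linarith, hf⟩
  -- the ray is endless for `-T`, hence eventually in `J⁺_{-T}(S) = J⁻(S)`
  have hend : IsFutureEndless γ (Ici 0) :=
    𝓢.timeOrientation.reverse.isFutureEndless_Ici_of_val_velocity_le hn1 (by norm_num)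
      fun s hs ↦ hray s hs
  obtain ⟨s₀, hs₀, hJ⟩ :=
    hS.reverse.exists_forall_mem_causalFuture_of_isFutureEndless hn2 hcurve hend
  -- two ray points: `b = γ s₀ ∈ J⁻(S)` and `a = γ (s₀ + 1) ∈ J⁺(S)` (tie), with `a ≪ b`
  have hlate : (⟨x₀ + (s₀ + 1) • E4.basisVector 0, trivial⟩ : Minkowski.background.domain) ∈
      Minkowski.background.lateRegion τ₀ := by
    change τ₀ < (x₀ + (s₀ + 1) • E4.basisVector 0) 0
    rw [hpt0]; linarith [le_max_left τ₀ τ₁]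
  have ha : γ (s₀ + 1) ∈ 𝓢.metric.causalFuture 𝓢.timeOrientation S := htie ⟨_, hlate, rfl⟩
  rw [LorentzianMetric.causalFuture_eq_biUnion] at ha
  simp only [mem_iUnion, exists_prop] at ha
  obtain ⟨σ, hσS, haσ⟩ := ha
  have hb : γ s₀ ∈ 𝓢.metric.causalFuture 𝓢.timeOrientation.reverse S := hJ s₀ le_rfl
  rw [LorentzianMetric.causalFuture_eq_biUnion] at hb
  simp only [mem_iUnion, exists_prop] at hb
  obtain ⟨σ', hσ'S, hbσ'⟩ := hb
  have hab : γ s₀ ∈ 𝓢.metric.chronologicalFuture 𝓢.timeOrientation {γ (s₀ + 1)} := by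
    have hseg : 𝓢.metric.IsFutureTimelikeCurveOn 𝓢.timeOrientation
        (fun t ↦ γ (s₀ + (s₀ + 1) - t)) (Icc s₀ (s₀ + 1)) :=
      LorentzianMetric.isFutureTimelikeCurveOn_reverse_reverse_iff.mp
        (hcurve.mono fun t ht ↦ mem_Ici.2 (hs₀.trans ht.1)).reverseParam
    refine ⟨γ (s₀ + 1), rfl, fun t ↦ γ (s₀ + (s₀ + 1) - t), s₀, s₀ + 1, by linarith, hseg, ?_, ?_⟩
    · show γ (s₀ + (s₀ + 1) - s₀) = γ (s₀ + 1)
      congr 1; ring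
    · show γ (s₀ + (s₀ + 1) - (s₀ + 1)) = γ s₀
      congr 1; ring
  -- push-up twice: `σ ≤ a ≪ b` gives `σ ≪ b`; `σ ≪ b ≤ σ'` gives `σ ≪ σ'` (time dual)
  have hσb : γ s₀ ∈ 𝓢.metric.chronologicalFuture 𝓢.timeOrientation {σ} :=
    LorentzianMetric.mem_chronologicalFuture_of_mem_causalFuture hn1 haσ hab
  have hσσ' : σ ∈ 𝓢.metric.chronologicalPast 𝓢.timeOrientation {σ'} :=
    LorentzianMetric.mem_chronologicalFuture_of_mem_causalFuture (τ := 𝓢.timeOrientation.reverse)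
      hn1 hbσ' (LorentzianMetric.mem_chronologicalPast_of_mem_chronologicalFuture hσb)
  -- achronality of the Cauchy hypersurface
  exact LorentzianMetric.IsCauchyHypersurface.isAchronal_holds hn2 hS σ hσS σ' hσ'S
    (LorentzianMetric.mem_chronologicalFuture_of_mem_chronologicalPast hσσ')

/-- **An asymptotically flat chart tied to a Cauchy hypersurface is future-oriented.** Under the
hypotheses of `soloBlind_not_antiOrientedBeyond_of_isCauchyHypersurface`, `dΨ(∂₀)` is timelike
and future-directed at every chart point with `x⁰ ≥ τ₁` (dichotomy of
`soloBlind_orientation_dichotomy` plus exclusion of the second branch). O'Neill 1983, Ch. 5,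
Lemma 5.26; Ch. 14, Lemma 14.29; Christodoulou–Klainerman 1993, Thm. 10.2.1. -/
theorem soloBlind_orientedBeyond_of_isCauchyHypersurface {S : Set 𝓢.carrier}
    (hS : 𝓢.metric.IsCauchyHypersurface 𝓢.timeOrientation S)
    {Ψ : Minkowski.background.domain → 𝓢.carrier} (hΨ : ContMDiff 𝓘(ℝ, E4) (𝓡 4) ∞ Ψ) (k : ℕ)
    {τ₀ τ₁ : ℝ} (hdev : ∀ τ, τ₁ ≤ τ →
      𝓢.deviationCk Minkowski.background Ψ k τ ≤ ENNReal.ofReal (1 / 10))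
    (htie : Ψ '' Minkowski.background.lateRegion τ₀ ⊆
      𝓢.metric.causalFuture 𝓢.timeOrientation S) :
    SoloBlindOrientedBeyond Ψ τ₁ :=
  (soloBlind_orientation_dichotomy hΨ k hdev).resolve_right
    (soloBlind_not_antiOrientedBeyond_of_isCauchyHypersurface hS hΨ k hdev htie)

end Spacetime

/-! ### Cauchy developments: hypothesis (d) of the tied flat chart is redundant -/

section Development

variable {X : Type} [TopologicalSpace X] [ChartedSpace E3 X] [IsManifold (𝓡 3) ∞ X]
  [ConnectedSpace X] {D : InitialDataSet (𝓡 3) X}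

/-- **In a Cauchy development, a `C⁰`-small flat chart tied to the data is future-oriented**: if
the `Cᵏ` deviation of the smooth chart read `Ψ : E4 → M` is at most `1/10` on the slabs
`{x⁰ = τ}`, `τ ≥ τ₁`, and `Ψ({x⁰ > τ₀}) ⊆ J⁺(ι X)`, then `dΨ(∂₀)` is future-directed timelike at
every chart point with `x⁰ ≥ τ₁`. O'Neill 1983, Ch. 14, Lemma 14.29; Christodoulou–Klainerman
1993, Thm. 10.2.1. -/
theorem soloBlind_orientedBeyond_of_cauchyDevelopment (𝒟 : CauchyDevelopment D)
    {Ψ : Minkowski.background.domain → 𝒟.carrier} (hΨ : ContMDiff 𝓘(ℝ, E4) (𝓡 4) ∞ Ψ) (k : ℕ)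
    {τ₀ τ₁ : ℝ} (hdev : ∀ τ, τ₁ ≤ τ →
      𝒟.toSpacetime.deviationCk Minkowski.background Ψ k τ ≤ ENNReal.ofReal (1 / 10))
    (htie : Ψ '' Minkowski.background.lateRegion τ₀ ⊆
      𝒟.metric.causalFuture 𝒟.timeOrientation (range 𝒟.embed)) :
    SoloBlindOrientedBeyond (𝓢 := 𝒟.toSpacetime) Ψ τ₁ :=
  soloBlind_orientedBeyond_of_isCauchyHypersurface 𝒟.isCauchyHypersurface hΨ k hdev htie

/-- **Hypothesis (d) of the tied flat chart is redundant.** A late-time embedding `Ψ` of the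
whole carrier of a Cauchy development after `τ₀` (a), with `Cᵏ` deviation tending to `0` (b) and
at most `1/10` in `Cᵏ'` from `τ₀` on (b'), whose late region lies in `J⁺(ι X)` (c), IS a tied
flat chart: (d) follows (`soloBlind_orientedBeyond_of_cauchyDevelopment`). Items (a), (b), (b')
are the recorded consequence form of the stability of Minkowski space with the chart exposed
(convergence AND closeness); (c) is gap F1. Christodoulou–Klainerman 1993, Thm. 1.0.3,
Thm. 10.2.1; Bieri 2010, Thm. 3. -/
def SoloBlindTiedFlatChart.ofDeviationLe (𝒟 : CauchyDevelopment D) {k k' : ℕ} (τ₀ : ℝ)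
    (Ψ : Minkowski.background.domain → 𝒟.carrier)
    (hemb : 𝒟.toSpacetime.IsLateEmbedding Minkowski.background univ τ₀ Ψ)
    (hlim : Tendsto (fun τ ↦ 𝒟.toSpacetime.deviationCk Minkowski.background Ψ k τ) atTop (𝓝 0))
    (hsmall : ∀ τ, τ₀ ≤ τ →
      𝒟.toSpacetime.deviationCk Minkowski.background Ψ k' τ ≤ ENNReal.ofReal (1 / 10))
    (htie : Ψ '' Minkowski.background.lateRegion τ₀ ⊆
      𝒟.metric.causalFuture 𝒟.timeOrientation (range 𝒟.embed)) :
    SoloBlindTiedFlatChart 𝒟 k where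
  τ₀ := τ₀
  chart := Ψ
  isLateEmbedding := hemb
  tendsto_deviationCk := hlim
  image_subset_causalFuture := htie
  isTimelike_isFutureDirected :=
    soloBlind_orientedBeyond_of_cauchyDevelopment 𝒟 hemb.contMDiff k' hsmall htie

/-- **Rung r1b with (d) discharged**: a vacuum Cauchy development with complete `𝓘⁺` carrying a
late-time embedding of its whole carrier which converges to `η` in `C²`, stays `1/10`-close in
`Cᵏ'` from `τ₀` on, and is tied to the data, satisfies the "settles down" conjunct of the
statement with NO black hole (`N = 0`, `O = J⁺(ι X)`). Christodoulou–Klainerman 1993, Thm. 1.0.3;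
Bieri 2010, Thm. 3. -/
theorem soloBlind_conclusion_of_tiedChart (𝒟 : VacuumCauchyDevelopment D)
    (hI : HasCompleteNullInfinity 𝒟.toCauchyDevelopment) {k' : ℕ} (τ₀ : ℝ)
    (Ψ : Minkowski.background.domain → 𝒟.carrier)
    (hemb : 𝒟.toSpacetime.IsLateEmbedding Minkowski.background univ τ₀ Ψ)
    (hlim : Tendsto (fun τ ↦ 𝒟.toSpacetime.deviationCk Minkowski.background Ψ 2 τ) atTop (𝓝 0))
    (hsmall : ∀ τ, τ₀ ≤ τ →
      𝒟.toSpacetime.deviationCk Minkowski.background Ψ k' τ ≤ ENNReal.ofReal (1 / 10))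
    (htie : Ψ '' Minkowski.background.lateRegion τ₀ ⊆
      𝒟.metric.causalFuture 𝒟.timeOrientation (range 𝒟.embed)) :
    HasCompleteNullInfinity 𝒟.toCauchyDevelopment ∧
      ∃ (O : Set 𝒟.carrier) (d : FinalStateDecomposition 𝒟.toSpacetime O 2),
        (∀ i, Kerr.IsSubextremal (d.mass i) (d.spin i)) ∧
          O = exteriorOf 𝒟.toCauchyDevelopment d.charted ∧
            RaysStayInClosure 𝒟.toCauchyDevelopment O ∧ HasExhaustiveCharts d ∧
              IsFutureOriented d :=
  soloBlind_conclusion_of_tiedFlatChart 𝒟 hI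
    (SoloBlindTiedFlatChart.ofDeviationLe 𝒟.toCauchyDevelopment τ₀ Ψ hemb hlim hsmall htie)

end Development

end Summit.FinalStateConjecture.FinalStateConjecture.Theorems

end
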